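import Summits.Ventures.PercRepro2.CaseOneStarCertT1
import Summits.Ventures.PercRepro2.CaseOneStarCertT2
import Summits.Ventures.PercRepro2.CaseOneStarCertT3
import Summits.Ventures.PercRepro2.CaseOneRootsAndBIQMain
import Summits.Ventures.PercRepro2.CaseOneCoreT
import Summits.Ventures.PercRepro2.CaseOneMarksOnly

/-!
# The marked star is an anchor of the six-form calculus; the marks-only anchor; the enlarged core
(blind cell PercRepro2, p1 g31)

**`iiT4_face_nonneg`**, **`iT4_face_nonneg`**: on the face `q₂ = 0` the T-world forms of the marked
star are `≥ 0` for all weights in `[0, 1]` and all cells satisfying `SFacts` (the slices, their Bernstein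
forms, the 72 certificates). Hence **`zSplitIIT_of_markedStar_null`**, **`zSplitIT_of_markedStar_null`**
(`(ii-T)`, `(i-T)` for the marked star with the `a₂`-edge null), **`sixForms_of_markedStar_null`**
(with the four forms of the star anchor), and by the `a₂`-edge rule **`closedAtT_of_markedStar`**: the
marked star has the SIX forms for EVERY weight vector. Then **`closedAtT_of_marksOnly`** (every
statement vertex whose edges all go to marks, any multiplicities — the four-star induction of
`CaseOneMarksOnly` on `ClosedAtT`), the anchors **`ClosedAnchorTS`** := `ClosedAnchorT ∨ MarkedStarAnchor`
with **`closedAtT_of_closedAnchorTS`**, and the core **`InCoreTS`** / **`closedAtT_of_coreTS`**: the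
six forms on the `a₂`-free residual core relative to these anchors give them everywhere. Own code;
standard axioms. -/

namespace Summit.Ventures.PercRepro2

namespace CaseOne

universe u

open RootsAndBIQ

section MainT
variable {R : Type*} [Field R] [LinearOrder R] [IsStrictOrderedRing R]

/-- **`iiT4 ≥ 0` on the face `q₂ = 0`** for weights in `[0, 1]` and cells satisfying the facts: the
`q₁`-slices are nonnegative by their `(r, s)`-Bernstein forms and the certificates. -/
theorem iiT4_face_nonneg (q₁ r s : R) (m : SCells R) (hf : SFacts m) (hq : 0 ≤ q₁) (hq' : q₁ ≤ 1)
    (hr : 0 ≤ r) (hr' : r ≤ 1) (hs : 0 ≤ s) (hs' : s ≤ 1) : 0 ≤ iiT4 q₁ 0 r s m := by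
  have Bq : ∀ k, 0 ≤ bern3 k q₁ := fun k => bern3_nonneg k hq hq'
  have Br : ∀ k, 0 ≤ bern3 k r := fun k => bern3_nonneg k hr hr'
  have Bs : ∀ k, 0 ≤ bern3 k s := fun k => bern3_nonneg k hs hs'
  have T : ∀ (c : R) (j k : ℕ), 0 ≤ c → 0 ≤ c * bern3 j r * bern3 k s :=
    fun c j k hc => mul_nonneg (mul_nonneg hc (Br j)) (Bs k)
  have h0 : 0 ≤ sII0 r s m := by
    rw [sII0_bern]
    have t02 := T _ 0 2 (tB002_nonneg m hf)
    have t03 := T _ 0 3 (tB003_nonneg m hf)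
    have t11 := T _ 1 1 (tB011_nonneg m hf)
    have t12 := T _ 1 2 (tB012_nonneg m hf)
    have t13 := T _ 1 3 (tB013_nonneg m hf)
    have t20 := T _ 2 0 (tB020_nonneg m hf)
    have t21 := T _ 2 1 (tB021_nonneg m hf)
    have t22 := T _ 2 2 (tB022_nonneg m hf)
    have t23 := T _ 2 3 (tB023_nonneg m hf)
    have t30 := T _ 3 0 (tB030_nonneg m hf)
    have t31 := T _ 3 1 (tB031_nonneg m hf)
    have t32 := T _ 3 2 (tB032_nonneg m hf)
    have t33 := T _ 3 3 (tB033_nonneg m hf)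
    linarith [t02, t03, t11, t12, t13, t20, t21, t22, t23, t30, t31, t32, t33]
  have h1 : 0 ≤ sII1 r s m := by
    rw [sII1_bern]
    have t01 := T _ 0 1 (tB101_nonneg m hf)
    have t02 := T _ 0 2 (tB102_nonneg m hf)
    have t03 := T _ 0 3 (tB103_nonneg m hf)
    have t10 := T _ 1 0 (tB110_nonneg m hf)
    have t11 := T _ 1 1 (tB111_nonneg m hf)
    have t12 := T _ 1 2 (tB112_nonneg m hf)
    have t13 := T _ 1 3 (tB113_nonneg m hf)
    have t20 := T _ 2 0 (tB120_nonneg m hf)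
    have t21 := T _ 2 1 (tB121_nonneg m hf)
    have t22 := T _ 2 2 (tB122_nonneg m hf)
    have t23 := T _ 2 3 (tB123_nonneg m hf)
    have t30 := T _ 3 0 (tB130_nonneg m hf)
    have t31 := T _ 3 1 (tB131_nonneg m hf)
    have t32 := T _ 3 2 (tB132_nonneg m hf)
    have t33 := T _ 3 3 (tB133_nonneg m hf)
    linarith [t01, t02, t03, t10, t11, t12, t13, t20, t21, t22, t23, t30, t31, t32, t33]
  have h2 : 0 ≤ sII2 r s m := by
    rw [sII2_bern]
    have t01 := T _ 0 1 (tB201_nonneg m hf)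
    have t02 := T _ 0 2 (tB202_nonneg m hf)
    have t10 := T _ 1 0 (tB210_nonneg m hf)
    have t11 := T _ 1 1 (tB211_nonneg m hf)
    have t12 := T _ 1 2 (tB212_nonneg m hf)
    have t20 := T _ 2 0 (tB220_nonneg m hf)
    have t21 := T _ 2 1 (tB221_nonneg m hf)
    have t22 := T _ 2 2 (tB222_nonneg m hf)
    linarith [t01, t02, t10, t11, t12, t20, t21, t22]
  have key : 0 ≤ 27 * iiT4 q₁ 0 r s m := by
    rw [iiT4_face_slices]
    exact add_nonneg (add_nonneg (mul_nonneg (Bq 0) h0) (mul_nonneg (Bq 1) h1)) (mul_nonneg (Bq 2) h2)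
  exact nonneg_of_mul_nonneg_right key (by norm_num)

/-- **`iT4 ≥ 0` on the face `q₂ = 0`** for weights in `[0, 1]` and cells satisfying the facts: the
`q₁`-slices are nonnegative by their `(r, s)`-Bernstein forms and the certificates. -/
theorem iT4_face_nonneg (q₁ r s : R) (m : SCells R) (hf : SFacts m) (hq : 0 ≤ q₁) (hq' : q₁ ≤ 1)
    (hr : 0 ≤ r) (hr' : r ≤ 1) (hs : 0 ≤ s) (hs' : s ≤ 1) : 0 ≤ iT4 q₁ 0 r s m := by
  have Bq : ∀ k, 0 ≤ bern3 k q₁ := fun k => bern3_nonneg k hq hq'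
  have Br : ∀ k, 0 ≤ bern3 k r := fun k => bern3_nonneg k hr hr'
  have Bs : ∀ k, 0 ≤ bern3 k s := fun k => bern3_nonneg k hs hs'
  have T : ∀ (c : R) (j k : ℕ), 0 ≤ c → 0 ≤ c * bern3 j r * bern3 k s :=
    fun c j k hc => mul_nonneg (mul_nonneg hc (Br j)) (Bs k)
  have h0 : 0 ≤ sI0 r s m := by
    rw [sI0_bern]
    have t02 := T _ 0 2 (tI002_nonneg m hf)
    have t03 := T _ 0 3 (tI003_nonneg m hf)
    have t11 := T _ 1 1 (tI011_nonneg m hf)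
    have t12 := T _ 1 2 (tI012_nonneg m hf)
    have t13 := T _ 1 3 (tI013_nonneg m hf)
    have t20 := T _ 2 0 (tI020_nonneg m hf)
    have t21 := T _ 2 1 (tI021_nonneg m hf)
    have t22 := T _ 2 2 (tI022_nonneg m hf)
    have t23 := T _ 2 3 (tI023_nonneg m hf)
    have t30 := T _ 3 0 (tI030_nonneg m hf)
    have t31 := T _ 3 1 (tI031_nonneg m hf)
    have t32 := T _ 3 2 (tI032_nonneg m hf)
    have t33 := T _ 3 3 (tI033_nonneg m hf)
    linarith [t02, t03, t11, t12, t13, t20, t21, t22, t23, t30, t31, t32, t33]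
  have h1 : 0 ≤ sI1 r s m := by
    rw [sI1_bern]
    have t01 := T _ 0 1 (tI101_nonneg m hf)
    have t02 := T _ 0 2 (tI102_nonneg m hf)
    have t03 := T _ 0 3 (tI103_nonneg m hf)
    have t10 := T _ 1 0 (tI110_nonneg m hf)
    have t11 := T _ 1 1 (tI111_nonneg m hf)
    have t12 := T _ 1 2 (tI112_nonneg m hf)
    have t13 := T _ 1 3 (tI113_nonneg m hf)
    have t20 := T _ 2 0 (tI120_nonneg m hf)
    have t21 := T _ 2 1 (tI121_nonneg m hf)
    have t22 := T _ 2 2 (tI122_nonneg m hf)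
    have t23 := T _ 2 3 (tI123_nonneg m hf)
    have t30 := T _ 3 0 (tI130_nonneg m hf)
    have t31 := T _ 3 1 (tI131_nonneg m hf)
    have t32 := T _ 3 2 (tI132_nonneg m hf)
    have t33 := T _ 3 3 (tI133_nonneg m hf)
    linarith [t01, t02, t03, t10, t11, t12, t13, t20, t21, t22, t23, t30, t31, t32, t33]
  have h2 : 0 ≤ sI2 r s m := by
    rw [sI2_bern]
    have t01 := T _ 0 1 (tI201_nonneg m hf)
    have t02 := T _ 0 2 (tI202_nonneg m hf)
    have t10 := T _ 1 0 (tI210_nonneg m hf)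
    have t11 := T _ 1 1 (tI211_nonneg m hf)
    have t12 := T _ 1 2 (tI212_nonneg m hf)
    have t20 := T _ 2 0 (tI220_nonneg m hf)
    have t21 := T _ 2 1 (tI221_nonneg m hf)
    have t22 := T _ 2 2 (tI222_nonneg m hf)
    linarith [t01, t02, t10, t11, t12, t20, t21, t22]
  have key : 0 ≤ 27 * iT4 q₁ 0 r s m := by
    rw [iT4_face_slices]
    exact add_nonneg (add_nonneg (mul_nonneg (Bq 0) h0) (mul_nonneg (Bq 1) h1)) (mul_nonneg (Bq 2) h2)
  exact nonneg_of_mul_nonneg_right key (by norm_num)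

end MainT

section StarT
variable {V : Type*} {E : Type*} [Fintype E] [DecidableEq E] [Fintype V] [DecidableEq V]
  {R : Type*} [Field R] [LinearOrder R] [IsStrictOrderedRing R]
variable {ends : E → Sym2 V} {o a₁ a₂ b a₃ : V} {e₁ e₂ eo eb : E}

/-- **`(ii-T)` for the marked star with the `a₂`-edge null.** -/
theorem zSplitIIT_of_markedStar_null (p : E → R) (hp : IsProbVec p)
    (h : IsMarkedStarAt ends o a₁ a₂ b a₃ e₁ e₂ eo eb) (h2 : p e₂ = 0) : ZSplitIIT p ends o a₁ a₂ a₃ b := by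
  unfold ZSplitIIT
  rw [iiExprT_eq_iiT4 p h, h2]
  have hp0 : IsProbVec (pin4 p e₁ e₂ eo eb) :=
    (((hp.update e₁ le_rfl zero_le_one).update e₂ le_rfl zero_le_one).update eo le_rfl zero_le_one).update
      eb le_rfl zero_le_one
  exact iiT4_face_nonneg _ _ _ _ (sFacts (pin4 p e₁ e₂ eo eb) hp0) (hp.nonneg e₁) (hp.le_one e₁)
    (hp.nonneg eo) (hp.le_one eo) (hp.nonneg eb) (hp.le_one eb)

/-- **`(i-T)` for the marked star with the `a₂`-edge null.** -/
theorem zSplitIT_of_markedStar_null (p : E → R) (hp : IsProbVec p)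
    (h : IsMarkedStarAt ends o a₁ a₂ b a₃ e₁ e₂ eo eb) (h2 : p e₂ = 0) : ZSplitIT p ends o a₁ a₂ a₃ b := by
  unfold ZSplitIT
  rw [iExprT_eq_iT4 p h, h2]
  have hp0 : IsProbVec (pin4 p e₁ e₂ eo eb) :=
    (((hp.update e₁ le_rfl zero_le_one).update e₂ le_rfl zero_le_one).update eo le_rfl zero_le_one).update
      eb le_rfl zero_le_one
  exact iT4_face_nonneg _ _ _ _ (sFacts (pin4 p e₁ e₂ eo eb) hp0) (hp.nonneg e₁) (hp.le_one e₁)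
    (hp.nonneg eo) (hp.le_one eo) (hp.nonneg eb) (hp.le_one eb)

/-- **The six forms for the marked star with the `a₂`-edge null.** -/
theorem sixForms_of_markedStar_null (p : E → R) (hp : IsProbVec p)
    (h : IsMarkedStarAt ends o a₁ a₂ b a₃ e₁ e₂ eo eb) (h2 : p e₂ = 0) : SixForms p ends o a₁ a₂ a₃ b := by
  obtain ⟨k1, k2, k3, k4⟩ := closedAt_of_closedAnchor (R := R) o a₁ a₂ b E ends a₃
    (Or.inr (Or.inl ⟨e₁, e₂, eo, eb, h⟩)) p hp
  exact ⟨k1, k2, zSplitIIT_of_markedStar_null p hp h h2, k3, k4, zSplitIT_of_markedStar_null p hp h h2⟩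

/-- **The marked star is an anchor of the six-form calculus**: the six forms for every weight vector
(the `a₂`-edge rule `closedAtT_of_a2_edges` from the face `q₂ = 0`). -/
theorem closedAtT_of_markedStar (h : IsMarkedStarAt ends o a₁ a₂ b a₃ e₁ e₂ eo eb) :
    ClosedAtT (R := R) o a₁ a₂ b E ends a₃ :=
  closedAtT_of_a2_edges fun p hp h0 => sixForms_of_markedStar_null p hp h (h0 e₂ h.ends_2)

end StarT

section MarksOnlyT
variable {V : Type*} [Fintype V] [DecidableEq V] {R : Type*} [Field R] [LinearOrder R]
  [IsStrictOrderedRing R]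
variable {o a₁ a₂ a₃ b : V}

/-- **The four-star induction for the six-form closed property**: a graph with four distinct edges
`x₁, x₂, xo, xb` at `a₃` to `a₁, a₂, o, b` in which every edge at `a₃` is parallel to one of them is
six-form closed — merge the other edges at `a₃` one by one down to the marked star. -/
theorem closedAtT_of_fourStar_aux (h1 : a₁ ≠ a₃) (h2 : a₂ ≠ a₃) (ho : o ≠ a₃) (hb : b ≠ a₃) :
    ∀ (n : ℕ) (E : Type u) [Fintype E] [DecidableEq E] (ends : E → Sym2 V) (x₁ x₂ xo xb : E),
      Fintype.card E = n → ends x₁ = s(a₁, a₃) → ends x₂ = s(a₂, a₃) → ends xo = s(o, a₃) →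
      ends xb = s(b, a₃) → x₁ ≠ x₂ → x₁ ≠ xo → x₁ ≠ xb → x₂ ≠ xo → x₂ ≠ xb → xo ≠ xb →
      (∀ e, a₃ ∈ ends e →
        ends e = s(a₁, a₃) ∨ ends e = s(a₂, a₃) ∨ ends e = s(o, a₃) ∨ ends e = s(b, a₃)) →
      ClosedAtT (R := R) o a₁ a₂ b E ends a₃ := by
  intro n
  induction n using Nat.strong_induction_on with
  | _ n ih =>
    intro E _ _ ends x₁ x₂ xo xb hn hx₁ hx₂ hxo hxb h12 h1o h1b h2o h2b hob hmarks
    by_cases hex : ∃ e, a₃ ∈ ends e ∧ e ≠ x₁ ∧ e ≠ x₂ ∧ e ≠ xo ∧ e ≠ xb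
    · -- an edge at `a₃` other than the four: parallel to one of them, merge it
      obtain ⟨e, he, he1, he2, heo, heb⟩ := hex
      have hlt : Fintype.card {f : E // f ≠ e} < n :=
        hn ▸ Fintype.card_subtype_lt (x := e) (by simp)
      have hsub : ClosedAtT (R := R) o a₁ a₂ b {f : E // f ≠ e} (restrictEnds ends e) a₃ :=
        ih _ hlt {f : E // f ≠ e} (restrictEnds ends e) ⟨x₁, he1.symm⟩ ⟨x₂, he2.symm⟩
          ⟨xo, heo.symm⟩ ⟨xb, heb.symm⟩ rfl hx₁ hx₂ hxo hxb (by simp [h12]) (by simp [h1o])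
          (by simp [h1b]) (by simp [h2o]) (by simp [h2b]) (by simp [hob])
          (fun f hf => hmarks f.1 hf)
      rcases hmarks e he with h | h | h | h
      · exact sixForms_of_thickStep (ThickStep.par E ends x₁ e (hx₁.trans h.symm) he1.symm) hsub
      · exact sixForms_of_thickStep (ThickStep.par E ends x₂ e (hx₂.trans h.symm) he2.symm) hsub
      · exact sixForms_of_thickStep (ThickStep.par E ends xo e (hxo.trans h.symm) heo.symm) hsub
      · exact sixForms_of_thickStep (ThickStep.par E ends xb e (hxb.trans h.symm) heb.symm) hsub
    · -- the four edges are the only edges at `a₃`: the marked star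
      push Not at hex
      refine closedAtT_of_markedStar (e₁ := x₁) (e₂ := x₂) (eo := xo) (eb := xb) ?_
      exact
        { ends_1 := hx₁
          ends_2 := hx₂
          ends_o := hxo
          ends_b := hxb
          ne_12 := h12
          ne_1o := h1o
          ne_1b := h1b
          ne_2o := h2o
          ne_2b := h2b
          ne_ob := hob
          unique := fun e he => by
            by_cases h1' : e = x₁
            · exact Or.inl h1'
            by_cases h2' : e = x₂
            · exact Or.inr (Or.inl h2')
            by_cases ho' : e = xo
            · exact Or.inr (Or.inr (Or.inl ho'))
            exact Or.inr (Or.inr (Or.inr (hex e he h1' h2' ho')))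
          ne_a1 := h1
          ne_a2 := h2
          ne_o := ho
          ne_b := hb }

/-- **A statement vertex `a₃ ∉ {a₁, a₂, o, b}` all of whose edges go to marks is six-form closed**:
four null edges to the marks, then the four-star induction. -/
theorem closedAtT_of_marksOnly' {E : Type u} [Fintype E] [DecidableEq E] {ends : E → Sym2 V}
    (hmarks : ∀ e, a₃ ∈ ends e →
      ends e = s(a₁, a₃) ∨ ends e = s(a₂, a₃) ∨ ends e = s(o, a₃) ∨ ends e = s(b, a₃))
    (h1 : a₁ ≠ a₃) (h2 : a₂ ≠ a₃) (ho : o ≠ a₃) (hb : b ≠ a₃) :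
    ClosedAtT (R := R) o a₁ a₂ b E ends a₃ := by
  refine closedAtT_of_ext (s := s(b, a₃)) (closedAtT_of_ext (s := s(o, a₃))
    (closedAtT_of_ext (s := s(a₂, a₃)) (closedAtT_of_ext (s := s(a₁, a₃)) ?_)))
  refine closedAtT_of_fourStar_aux h1 h2 ho hb _ _ _ none (some none) (some (some none))
    (some (some (some none))) rfl rfl rfl rfl rfl (by simp) (by simp) (by simp) (by simp) (by simp)
    (by simp) ?_
  intro e he
  rcases e with _ | _ | _ | _ | e
  · exact Or.inl rfl
  · exact Or.inr (Or.inl rfl)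
  · exact Or.inr (Or.inr (Or.inl rfl))
  · exact Or.inr (Or.inr (Or.inr rfl))
  · exact hmarks e he

/-- **Every statement vertex whose neighbours are all marks is six-form closed** — any multiplicities,
any coincidences among the marks, the statement vertex itself possibly a mark. -/
theorem closedAtT_of_marksOnly {E : Type u} [Fintype E] [DecidableEq E] {ends : E → Sym2 V}
    (hmarks : ∀ e, a₃ ∈ ends e →
      ends e = s(a₁, a₃) ∨ ends e = s(a₂, a₃) ∨ ends e = s(o, a₃) ∨ ends e = s(b, a₃)) :
    ClosedAtT (R := R) o a₁ a₂ b E ends a₃ := by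
  by_cases h1 : a₁ = a₃
  · subst h1; exact closedAtT_of_a1_eq_a3 o a₁ a₂ b
  by_cases h2 : a₂ = a₃
  · subst h2; exact closedAtT_of_a2_eq_a3 o a₁ a₂ b
  by_cases ho : o = a₃
  · subst ho; exact closedAtT_of_o_eq_a3 a₁ a₂ o b
  by_cases hb : b = a₃
  · subst hb; exact closedAtT_of_b_eq_a3 o a₁ a₂ b
  exact closedAtT_of_marksOnly' hmarks h1 h2 ho hb

end MarksOnlyT

section AnchorsTS
variable {V : Type*}

/-- **The closed anchors of the six-form calculus with the marked star**: `ClosedAnchorT` or a marked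
star (the uwob gadget is the one four-form anchor still missing). -/
def ClosedAnchorTS (o a₁ a₂ b : V) (E : Type u) (ends : E → Sym2 V) (v : V) : Prop :=
  ClosedAnchorT o a₁ a₂ b E ends v ∨ MarkedStarAnchor o a₁ a₂ b E ends v

variable (o a₁ a₂ b : V) [Fintype V] [DecidableEq V] {R : Type*} [Field R] [LinearOrder R]
  [IsStrictOrderedRing R]

/-- **A `ClosedAnchorTS` anchor is six-form closed.** -/
theorem closedAtT_of_closedAnchorTS (E : Type u) [Fintype E] [DecidableEq E] (ends : E → Sym2 V)
    (v : V) (h : ClosedAnchorTS o a₁ a₂ b E ends v) : ClosedAtT (R := R) o a₁ a₂ b E ends v := by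
  rcases h with h | ⟨e₁, e₂, eo, eb, h⟩
  · exact closedAtT_of_closedAnchorT o a₁ a₂ b E ends v h
  · exact closedAtT_of_markedStar h

variable (v : V)

/-- **The `a₂`-free residual core relative to `ClosedAnchorTS`.** -/
def InCoreTS (E : Type u) [Fintype E] [DecidableEq E] (ends : E → Sym2 V) : Prop :=
  InCoreTAnc o a₁ a₂ b v (fun E₀ _ _ ends₀ v₀ => ClosedAnchorTS o a₁ a₂ b E₀ ends₀ v₀) E ends

/-- **The reduction to the `a₂`-free residual core with the marked-star anchor.** -/
theorem closedAtT_of_coreTS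
    (hcore : ∀ (E' : Type u) [Fintype E'] [DecidableEq E'] (ends' : E' → Sym2 V),
      InCoreTS o a₁ a₂ b v E' ends' → ClosedAtT (R := R) o a₁ a₂ b E' ends' v) :
    ∀ (E : Type u) [Fintype E] [DecidableEq E] (ends : E → Sym2 V),
      ClosedAtT (R := R) o a₁ a₂ b E ends v :=
  closedAtT_of_coreTAnc o a₁ a₂ b v _
    (fun E₀ _ _ ends₀ v₀ h => closedAtT_of_closedAnchorTS o a₁ a₂ b E₀ ends₀ v₀ h) hcore

end AnchorsTS

end CaseOne

end Summit.Ventures.PercRepro2
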